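import Mathlib.Algebra.BigOperators.Fin
import Mathlib.Algebra.BigOperators.Ring.Finset
import Mathlib.Data.Fin.Tuple.Basic
import Mathlib.Algebra.Ring.Hom.Defs
import Mathlib.Algebra.BigOperators.RingEquiv
import Mathlib.Tactic.Ring
import HarnessLib

/-!
# Kronecker-power transforms by rounds of single-mode products on flat arrays (Pratt, Thm. 1.9)

Topic `Computability/AlgebraicComplexity`. Pure bookkeeping for the word-RAM implementation of the
algorithm of Pratt, STOC 2024, Thm. 1.9 (§2: evaluating `T_k^{⊗r}` "using `O((R̃(T_k)+ε/2)^r)`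
field operations", i.e. the recursive/iterative algorithm for Kronecker powers of a bilinear or
trilinear decomposition — here the three linear transforms `x ↦ A^{⊗j} x` applied mode by mode).
An array of `j`-index data is stored FLAT, little-endian: after `g` rounds the cell
`u + R^g · q` with `u = flatIdx ℓ_{<g}` (base `R`) and `q = s_g + Nm · (s_{g+1} + …)` (base `Nm`) holds
the partially transformed entry `∑_{s_{<g}} (∏_{i<g} M_{ℓ_i s_i}) x(s_{<g}, s_{≥g})`.

* `flatIdx m f = ∑_i f_i m^i` for `f : Fin n → Fin m`, with `flatIdx_lt`, `flatIdx_snoc`;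
* `modeStep M R Nm g` — round `g`: `new[u + R^g (ℓ + R v)] = ∑_{s<Nm} M ℓ s · old[u + R^g (s + Nm v)]`,
  addresses decoded by `div`/`mod` exactly as the machine does; `modeIter` — `g` rounds;
* **`modeIter_flat`** — after `j` rounds, cell `flatIdx ℓ` holds `∑_{s : [j] → [Nm]} (∏_i M_{ℓ_i s_i}) x(flatIdx s)`,
  the `j`-fold Kronecker power of the matrix `M` applied to `x` (the generalised invariant is
  `modeIter_flat_add`);
* `modeStep_map`/`modeIter_map` — the rounds commute with ring homomorphisms (the machine works in
  `ℤ/2^w`, the meaning is in `ℤ`).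

## References

* [Pratt2024SCC] K. Pratt, STOC 2024, arXiv:2311.02774 — §1.1 (Kronecker powers from a rank
  decomposition), §2 (proof of Thm. 1.9).
* [BurgisserClausenShokrollahi1997] P. Bürgisser, M. Clausen, M. A. Shokrollahi, *Algebraic Complexity
  Theory*, §14.6/(15.24) (tensor products of bilinear algorithms).
-/

open scoped BigOperators

namespace Literature.Computability.AlgebraicComplexity

/-! ## Flat little-endian indices -/

/-- The flat little-endian index of a tuple of digits in base `m`: `∑_i f_i m^i`
(the coordinate of `finFunctionFinEquiv`). [folklore] -/
def flatIdx (m : ℕ) {n : ℕ} (f : Fin n → Fin m) : ℕ := ∑ i, (f i : ℕ) * m ^ (i : ℕ)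

/-- `flatIdx` is the value of `finFunctionFinEquiv`. [folklore] -/
theorem flatIdx_eq_finFunctionFinEquiv (m : ℕ) {n : ℕ} (f : Fin n → Fin m) :
    flatIdx m f = (finFunctionFinEquiv f : ℕ) := rfl

/-- Flat indices are below `m^n`. [folklore] -/
theorem flatIdx_lt (m : ℕ) {n : ℕ} (f : Fin n → Fin m) : flatIdx m f < m ^ n := by
  rw [flatIdx_eq_finFunctionFinEquiv]; exact Fin.is_lt _

/-- `flatIdx` is injective. [folklore] -/
theorem flatIdx_injective (m n : ℕ) : Function.Injective (flatIdx m : (Fin n → Fin m) → ℕ) := by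
  intro f g h
  rw [flatIdx_eq_finFunctionFinEquiv, flatIdx_eq_finFunctionFinEquiv] at h
  exact finFunctionFinEquiv.injective (Fin.ext h)

/-- The empty tuple has flatIdx index `0`. [folklore] -/
@[simp] theorem flatIdx_zero (m : ℕ) (f : Fin 0 → Fin m) : flatIdx m f = 0 := by simp [flatIdx]

/-- Appending a most significant digit. [folklore] -/
theorem flatIdx_snoc (m : ℕ) {n : ℕ} (f : Fin n → Fin m) (a : Fin m) :
    flatIdx m (Fin.snoc f a : Fin (n + 1) → Fin m) = flatIdx m f + (a : ℕ) * m ^ n := by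
  rw [flatIdx, Fin.sum_univ_castSucc]
  simp only [Fin.snoc_castSucc, Fin.val_castSucc, Fin.snoc_last, Fin.val_last]
  rfl

/-! ## One round of single-mode products on a flat array -/

section Mode

variable {α : Type*} [CommSemiring α]

/-- **Round `g`**: the cell `a = u + R^g · q`, `q = ℓ + R v` (`u < R^g`, `ℓ < R`), receives
`∑_{s < Nm} M ℓ s · old[u + R^g (s + Nm v)]`. [cite: Pratt2024SCC, §2 (proof of Thm. 1.9)] -/
def modeStep (M : ℕ → ℕ → α) (R Nm g : ℕ) (old : ℕ → α) : ℕ → α := fun a =>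
  ∑ s ∈ Finset.range Nm, M (a / R ^ g % R) s * old (a % R ^ g + R ^ g * (s + Nm * (a / R ^ g / R)))

/-- `g` rounds, modes `0, …, g-1` in turn. [cite: Pratt2024SCC, §2 (proof of Thm. 1.9)] -/
def modeIter (M : ℕ → ℕ → α) (R Nm : ℕ) : ℕ → (ℕ → α) → ℕ → α
  | 0, x => x
  | g + 1, x => modeStep M R Nm g (modeIter M R Nm g x)

/-- The value written in round `g`, with the address already decoded. [folklore] -/
theorem modeStep_apply_decoded (M : ℕ → ℕ → α) {R Nm g : ℕ} (old : ℕ → α) {u ℓ v : ℕ}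
    (hu : u < R ^ g) (hℓ : ℓ < R) :
    modeStep M R Nm g old (u + R ^ g * (ℓ + R * v)) =
      ∑ s ∈ Finset.range Nm, M ℓ s * old (u + R ^ g * (s + Nm * v)) := by
  have hR : 0 < R := by omega
  have hRg : 0 < R ^ g := Nat.pos_of_ne_zero (by rintro h; rw [h] at hu; exact Nat.not_lt_zero _ hu)
  have hq : (u + R ^ g * (ℓ + R * v)) / R ^ g = ℓ + R * v := by
    rw [Nat.add_mul_div_left _ _ hRg, Nat.div_eq_of_lt hu, Nat.zero_add]
  have hm : (u + R ^ g * (ℓ + R * v)) % R ^ g = u := by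
    rw [Nat.add_mul_mod_self_left, Nat.mod_eq_of_lt hu]
  unfold modeStep
  rw [hq, hm, Nat.add_mul_mod_self_left, Nat.mod_eq_of_lt hℓ, Nat.add_mul_div_left _ _ hR,
    Nat.div_eq_of_lt hℓ, Nat.zero_add]

/-- **The invariant of the rounds**: after `g` rounds, the cell `flatIdx ℓ + R^g · T`
(`ℓ : [g] → [R]`, any `T`) holds `∑_{s : [g] → [Nm]} (∏_{i<g} M_{ℓ_i s_i}) · x(flatIdx s + Nm^g · T)`.
[cite: Pratt2024SCC, §2 (proof of Thm. 1.9)] -/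
theorem modeIter_flat_add (M : ℕ → ℕ → α) {R Nm : ℕ} (x : ℕ → α) :
    ∀ (g : ℕ) (ℓ : Fin g → Fin R) (T : ℕ),
      modeIter M R Nm g x (flatIdx R ℓ + R ^ g * T) =
        ∑ s : Fin g → Fin Nm, (∏ i, M (ℓ i) (s i)) * x (flatIdx Nm s + Nm ^ g * T)
  | 0, ℓ, T => by simp [modeIter]
  | g + 1, ℓ, T => by
    classical
    -- decode the address: `flatIdx ℓ + R^(g+1) T = flatIdx (init ℓ) + R^g (ℓ_g + R T)`
    have haddr : flatIdx R ℓ + R ^ (g + 1) * T = flatIdx R (Fin.init ℓ) + R ^ g * ((ℓ (Fin.last g) : ℕ) + R * T) := by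
      conv_lhs => rw [← Fin.snoc_init_self ℓ, flatIdx_snoc]
      rw [pow_succ]; ring
    rw [modeIter, haddr, modeStep_apply_decoded M _ (flatIdx_lt R _) (Fin.is_lt _)]
    -- the cells read were computed in the previous rounds
    have hread : ∀ s, s < Nm →
        modeIter M R Nm g x (flatIdx R (Fin.init ℓ) + R ^ g * (s + Nm * T)) =
          ∑ s' : Fin g → Fin Nm, (∏ i, M (Fin.init ℓ i) (s' i)) * x (flatIdx Nm s' + Nm ^ g * (s + Nm * T)) :=
      fun s _ => modeIter_flat_add M x g (Fin.init ℓ) (s + Nm * T)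
    rw [Finset.sum_congr rfl fun s hs => by rw [hread s (Finset.mem_range.1 hs)]]
    -- regroup: tuples of length `g + 1` are a last digit and a tuple of length `g`
    rw [← Fin.sum_univ_eq_sum_range (fun s => M (ℓ (Fin.last g) : ℕ) s *
      ∑ s' : Fin g → Fin Nm, (∏ i, M (Fin.init ℓ i) (s' i)) * x (flatIdx Nm s' + Nm ^ g * (s + Nm * T))) Nm]
    rw [← Fintype.sum_equiv (Fin.snocEquiv fun _ => Fin Nm) _ _ (fun _ => rfl), Fintype.sum_prod_type]
    refine Finset.sum_congr rfl fun s _ => ?_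
    rw [Finset.mul_sum]
    refine Finset.sum_congr rfl fun s' _ => ?_
    have hsn : (Fin.snocEquiv fun _ => Fin Nm) (s, s') = Fin.snoc s' s := rfl
    have hidx : flatIdx Nm s' + Nm ^ g * ((s : ℕ) + Nm * T) =
        flatIdx Nm (Fin.snoc s' s : Fin (g + 1) → Fin Nm) + Nm ^ (g + 1) * T := by
      rw [flatIdx_snoc, pow_succ]; ring
    rw [hsn, hidx]
    simp only [Fin.prod_univ_castSucc, Fin.snoc_castSucc, Fin.snoc_last, Fin.init]
    ring

/-- **After all `j` rounds** the array holds the `j`-fold Kronecker power of `M` applied to `x`: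
cell `flatIdx ℓ` is `∑_{s : [j] → [Nm]} (∏_i M_{ℓ_i s_i}) · x(flatIdx s)`. [cite: Pratt2024SCC, §2 (proof of Thm. 1.9)] -/
theorem modeIter_flat (M : ℕ → ℕ → α) {R Nm : ℕ} (x : ℕ → α) (j : ℕ) (ℓ : Fin j → Fin R) :
    modeIter M R Nm j x (flatIdx R ℓ) = ∑ s : Fin j → Fin Nm, (∏ i, M (ℓ i) (s i)) * x (flatIdx Nm s) := by
  have := modeIter_flat_add M (Nm := Nm) x j ℓ 0
  simpa using this

end Mode

/-! ## The rounds commute with ring homomorphisms -/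

section Map

variable {α β : Type*} [CommSemiring α] [CommSemiring β]

/-- One round commutes with ring homomorphisms. [folklore] -/
theorem modeStep_map (φ : α →+* β) (M : ℕ → ℕ → α) (R Nm g : ℕ) (old : ℕ → α) (a : ℕ) :
    φ (modeStep M R Nm g old a) = modeStep (fun ℓ s => φ (M ℓ s)) R Nm g (fun b => φ (old b)) a := by
  simp [modeStep, map_sum, map_mul]

/-- All rounds commute with ring homomorphisms. [folklore] -/
theorem modeIter_map (φ : α →+* β) (M : ℕ → ℕ → α) (R Nm : ℕ) :
    ∀ (g : ℕ) (x : ℕ → α) (a : ℕ),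
      φ (modeIter M R Nm g x a) = modeIter (fun ℓ s => φ (M ℓ s)) R Nm g (fun b => φ (x b)) a
  | 0, x, a => rfl
  | g + 1, x, a => by
    rw [modeIter, modeIter, modeStep_map]
    unfold modeStep
    refine Finset.sum_congr rfl fun s _ => ?_
    simp only [modeIter_map φ M R Nm g x]

end Map

end Literature.Computability.AlgebraicComplexity
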